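import Mathlib

/-!
# The Rayleigh weight identity behind the steady non-resonance lemma (solo-blind, s43)

For a parallel profile `U` without zeros, the substitution `φ = U ψ` turns the stationary (`c = 0`)
Rayleigh operator into a divergence form:

  `U ((U ψ)'' - k² U ψ) - U'' (U ψ) = (U² ψ')' - k² U² ψ`,

and pairing with `ψ` gives the coercive integrand identity

  `((U² ψ')' - k² U² ψ) ψ = (U² ψ' ψ)' - U² (ψ'² + k² ψ²)`.

Integrated over a period (or a line with decay) the total derivative drops out, which is Rayleigh's
1880 argument that a zero-free profile carries no stationary inviscid wave, uniformly in `U''` — the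
inviscid core of step L3(i) of the programme (paper §24.24–24.25, CLAIMS SB-C438/C440).  This file
records the calculus (Leibniz expansions as `HasDerivAt` facts) and the two pointwise identities.
-/

namespace Summit.AnomalousDissipation.AnomalousDissipation.Theorems

/-- Leibniz: `(U ψ)' = U' ψ + U ψ'`. -/
theorem hasDerivAt_weight_first {U ψ : ℝ → ℝ} {u1 p1 y : ℝ} (hU : HasDerivAt U u1 y)
    (hψ : HasDerivAt ψ p1 y) : HasDerivAt (fun x => U x * ψ x) (u1 * ψ y + U y * p1) y :=
  hU.mul hψ

/-- Second Leibniz step: `(U' ψ + U ψ')' = U'' ψ + 2 U' ψ' + U ψ''`. -/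
theorem hasDerivAt_weight_second {U U1 ψ ψ1 : ℝ → ℝ} {u2 p2 y : ℝ} (hU : HasDerivAt U (U1 y) y)
    (hU1 : HasDerivAt U1 u2 y) (hψ : HasDerivAt ψ (ψ1 y) y) (hψ1 : HasDerivAt ψ1 p2 y) :
    HasDerivAt (fun x => U1 x * ψ x + U x * ψ1 x) (u2 * ψ y + 2 * U1 y * ψ1 y + U y * p2) y := by
  have h := (hU1.mul hψ).add (hU.mul hψ1)
  have h2 : HasDerivAt (fun x => U1 x * ψ x + U x * ψ1 x)
      (u2 * ψ y + U1 y * ψ1 y + (U1 y * ψ1 y + U y * p2)) y := h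
  refine h2.congr_deriv ?_
  ring

/-- Flux derivative: `(U² ψ')' = 2 U U' ψ' + U² ψ''`. -/
theorem hasDerivAt_flux {U ψ1 : ℝ → ℝ} {u1 p2 y : ℝ} (hU : HasDerivAt U u1 y)
    (hψ1 : HasDerivAt ψ1 p2 y) :
    HasDerivAt (fun x => U x ^ 2 * ψ1 x) (2 * U y * u1 * ψ1 y + U y ^ 2 * p2) y := by
  have h := (hU.pow 2).mul hψ1
  have h2 : HasDerivAt (fun x => U x ^ 2 * ψ1 x)
      ((↑(2:ℕ) * U y ^ (2 - 1) * u1) * ψ1 y + U y ^ 2 * p2) y := h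
  refine h2.congr_deriv ?_
  push_cast; ring

/-- RAYLEIGH WEIGHT IDENTITY (pointwise, in terms of the derivative values supplied by the two Leibniz
lemmas): with `φ = Uψ`, `φ'' = U''ψ + 2U'ψ' + Uψ''` and `(U²ψ')' = 2UU'ψ' + U²ψ''`,
`U (φ'' - k² φ) - U'' φ = (U² ψ')' - k² U² ψ`. -/
theorem rayleigh_weight_identity (u u1 u2 p p1 p2 k : ℝ) :
    u * ((u2 * p + 2 * u1 * p1 + u * p2) - k ^ 2 * (u * p)) - u2 * (u * p)
      = (2 * u * u1 * p1 + u ^ 2 * p2) - k ^ 2 * (u ^ 2 * p) := by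
  ring

/-- Derivative of the boundary flux `U² ψ' ψ`. -/
theorem hasDerivAt_boundary_flux {U ψ ψ1 : ℝ → ℝ} {u1 p2 y : ℝ} (hU : HasDerivAt U u1 y)
    (hψ : HasDerivAt ψ (ψ1 y) y) (hψ1 : HasDerivAt ψ1 p2 y) :
    HasDerivAt (fun x => U x ^ 2 * ψ1 x * ψ x)
      ((2 * U y * u1 * ψ1 y + U y ^ 2 * p2) * ψ y + U y ^ 2 * ψ1 y * ψ1 y) y := by
  exact (hasDerivAt_flux hU hψ1).mul hψ

/-- COERCIVE INTEGRAND IDENTITY (pointwise): `((U²ψ')' - k²U²ψ) ψ = (U²ψ'ψ)' - U²(ψ'² + k²ψ²)`.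
Integrated over a period the first term on the right vanishes, leaving `-∫ U² (ψ'² + k² ψ²) ≤ 0`,
with equality only for `ψ = 0` when `k ≠ 0` and `U` has no zero. -/
theorem coercive_integrand_identity (u u1 p p1 p2 k : ℝ) :
    ((2 * u * u1 * p1 + u ^ 2 * p2) - k ^ 2 * (u ^ 2 * p)) * p
      = ((2 * u * u1 * p1 + u ^ 2 * p2) * p + u ^ 2 * p1 * p1) - u ^ 2 * (p1 ^ 2 + k ^ 2 * p ^ 2) := by
  ring

/-- The sign fact that makes the identity coercive: for `u ≠ 0`, `k ≠ 0` the quadratic form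
`u² (p1² + k² p²)` vanishes only at `p = p1 = 0`. -/
theorem coercive_form_eq_zero {u k p p1 : ℝ} (hu : u ≠ 0) (hk : k ≠ 0)
    (h : u ^ 2 * (p1 ^ 2 + k ^ 2 * p ^ 2) = 0) : p = 0 ∧ p1 = 0 := by
  have hu2 : 0 < u ^ 2 := by positivity
  have hsum : p1 ^ 2 + k ^ 2 * p ^ 2 = 0 := by
    rcases mul_eq_zero.mp h with h | h
    · exact absurd h (ne_of_gt hu2)
    · exact h
  have hp1 : p1 ^ 2 = 0 := by nlinarith [sq_nonneg p1, sq_nonneg (k * p)]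
  have hkp : (k * p) ^ 2 = 0 := by nlinarith [sq_nonneg p1, sq_nonneg (k * p)]
  refine ⟨?_, pow_eq_zero_iff (n := 2) (by norm_num) |>.mp hp1⟩
  have := pow_eq_zero_iff (n := 2) (by norm_num) |>.mp hkp
  rcases mul_eq_zero.mp this with h | h
  · exact absurd h hk
  · exact h

end Summit.AnomalousDissipation.AnomalousDissipation.Theorems
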